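import Summits.BirchSwinnertonDyer.BirchSwinnertonDyer.Theses.UniversalToricDescent
import Summits.BirchSwinnertonDyer.BirchSwinnertonDyer.Theorems.UniversalToricDescentTwinAlgMuZeroAtThreeOfBetaRoadParam
import Summits.BirchSwinnertonDyer.BirchSwinnertonDyer.Theorems.UniversalToricDescentAcDualMuZeroCriterion
import Summits.BirchSwinnertonDyer.BirchSwinnertonDyer.Theorems.UniversalToricDescentResidualLinkOfLayerCount
import Summits.BirchSwinnertonDyer.BirchSwinnertonDyer.Theorems.UniversalToricDescentStrictPlaceNoPTorsion
import Literature.NumberTheory.EllipticCurves.KatoFineSelmerDual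
import HarnessLib

/-!
# Crux r205 `TwinAlgMuZeroAtThree` (stmt-BirchSwinnertonDyer-24737) — node `dihedral-parity-squeeze` (crux-ideate g14, 2026-08-31)

**THE MOVE (count the `μ`-summands mod 2; the dihedral involution makes the Cassels–Tate form alternating).**
Write `Λ = ℤ₃⟦T⟧` (anticyclotomic, `ι : γ ↦ γ⁻¹`, `τ` = complex conjugation, `τγτ = γ⁻¹`), `Ω = Λ/3 = 𝔽₃⟦T⟧`, and in bucket B
(multiplicative, très ramifié at `3`, so Greenberg's ordinary condition above `𝔭 ∣ 3` IS the Kummer condition, residually of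
`Ω`-corank one) let `X = X_Gr(E′/K_∞)` be the dual of the classical Selmer group `Sel(K_∞, E′[3^∞]) = lim Sel(E′/K_n)`.  Three integers:
`r = rank_Λ X`;  `s₀ = #{μ-summands Λ/3^k of X}`;  `s_Gr = r + s₀` = the `Ω`-corank of `Sel(K_∞, E′[3])`, i.e. the GROWTH RATE
`dim_{𝔽₃} Sel₃(E′/K_n) = s_Gr · 3ⁿ + O(1)` of the residual Selmer groups of the layers (the tree's `selmerTorsionOver`).

  (P) SQUARE AT (3).  Localise at the height-one prime `(3)`: `Λ_(3)` is a DVR with uniformiser `3`, `2 ∈ Λ_(3)^×`, and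
      `(X_tors)_(3) = ⊕ Λ_(3)/3^{k_i}` has finite length.  Nekovář's `Λ`-adic generalised Cassels–Tate pairing (Flach's at finite
      level) is `ι`-sesquilinear, skew-Hermitian, perfect on `X_tors` modulo pseudo-null (= finite, killed by `⊗ Λ_(3)`), and
      `Gal(K_∞/ℚ)`-equivariant: `CT(τx, τy) = ι CT(x, y)`.  The TWIST `B(x, y) := CT(x, τy)` is then `Λ_(3)`-BILINEAR (τ is `ι`-semilinear,
      cancelling the sesquilinearity), perfect, antisymmetric, hence alternating (`2` a unit), hence `(X_tors)_(3) ≅ M ⊕ M`:  `s₀` is EVEN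
      (and `μ(X)` is even).  Skew-Hermitian ALONE does not do this (`Λ_(3)/3^k` with the form `a/3^k`, `ι(a) = −a`, is perfect
      skew-Hermitian of length one — but admits no compatible `τ`): the cyclotomic tower, which has no `τ`, allows odd `μ` (11a1, `p = 5`);
      the dihedral tower does not.  Finite-level shape = Howard's H.4 (`T* ≅ Tw(T)`, `𝓕* = 𝓕^τ`) and Thm. 1.4.2 `H¹_𝓕 ≅ R^ε ⊕ M ⊕ M`, typed
      cite-only in the tree (`Literature.NumberTheory.GaloisCohomology.Howard2004.CasselsTateSkewPairing`; kernel parity forms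
      `…CasselsTateSkewPairingParityFormProofs.even_length_torsionLayer_of_linearEquiv_prod_prod`). [cite: Nekovar2006, §10.2–§10.5, 10.7.15]
      [cite: Flach1990, Thm. 1–2] [cite: Howard2004HeegnerKolyvagin, Prop. 1.4.1, Thm. 1.4.2, H.4]
  (R) RANK PARITY.  `r` is ODD: `3`-parity for `E′/K` (`cork Sel_{3^∞}(E′/K) ≡ r_an(E′) + r_an(E′^{d_K}) = ord_{s=1} L(E′/K, s) ≡ 1`, sign `−1`
      by the Heegner hypothesis) [cite: DokchitserDokchitserAnnals2010, Thm. 1.2 (p-parity for all E/ℚ)] and the bottom-to-`Λ` transfer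
      `cork Sel(E′/K) ≡ rank_Λ X (mod 2)` = the SAME square at the height-one prime `(T)` plus `τ`-PAIRED control defects (the
      exceptional-zero defect of a split-multiplicative `3` occurs at `𝔭` AND at `𝔭′ = τ𝔭`) [cite: Nekovar2006, 10.7.15(iii), 10.7.17, 10.7.19]
      [cite: MatarNekovar2019, Prop. 3.2(1) (good ordinary there)] [cite: MazurRubin2007, Thm. 3.1 (good ordinary, (Tam), (Zero) there)].
      In particular `r ≥ 1` comes for free (no Cornut–Vatsal, no Kolyvagin).
  (P) ∧ (R) ⟹ ODD‴: `s_Gr` is ODD.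
  (D) THE τ-POITOU–TATE DICHOTOMY (pure `Ω`-corank algebra; all `Ω`-torsion in sight is finite because `E′(K_{∞,w})[3] = 0`):
      `G = H¹(K_Σ/K_∞, E′[3])` has corank `2 + h²`; the image `𝓘` of `G` in `⊕_{v∈Σ} H¹(K_{∞,v}, E′[3])` has corank EXACTLY `2`
      (Poitou–Tate: the image over `K_n` is maximal isotropic, `dim = ½ · (4·3ⁿ + O(1))`); `s_fine = h²`;
      `s_(∅,0) = s_fine + a` with `a = corank(𝓘 ∩ L_𝔭) = corank(𝓘 ∩ L_𝔭′)` (τ) so `a ≤ 1`;  `s_Gr = s_fine + corank(𝓘 ∩ (ℓ ⊕ τℓ))`,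
      `ℓ ⊂ L_𝔭` the toric (Kummer) line.  If `a = 1` then `𝓘 ≈ 𝓐 ⊕ τ𝓐` with `𝓐 ⊂ L_𝔭` of corank one, and
      `corank(𝓘 ∩ (ℓ ⊕ τℓ)) = 2 · corank(𝓐 ∩ ℓ)` is EVEN.  Hence:   `s_Gr − s_fine` odd  ⟹  `a = 0`  ⟹  `s_(∅,0) = s_fine`.
  With FINE‴ (`s_fine = 0`) and ODD‴:  `Sel_(∅,0)(K_∞, E′[3^∞])[3]` is finite ⟹ (route receptacle) `X_(∅,0)` is `Λ`-torsion with `μ = 0` = crux_B.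

So in bucket B the crux is cut as   crux_B ⟸ FINE‴ ∧ ODD‴ ∧ CUT‴ :
* FINE‴ `FineSelmerThreeTorsionFiniteAtThree` — verbatim the g8/g9 piece.  TAG: WEAKER than the crux (PROVED here: `fine_of_crux`) ·
  INSTRUMENTABLE per twin · class-wide IDEA-NEEDED (anticyclotomic Coates–Sujatha A at `3`; equivalently the residual `H²`-rate
  `h² = 0`, see (D)). [cite: CoatesSujatha2005, Conj. A] [cite: Matar2018, Conj. B, Thm. 4.1]
* ODD‴ `SelmerLayerGrowthOddMultAtThree` — «`#Sel₃(E′/K_n) = 3^{s·3ⁿ + O(1)}` with `s` ODD» (bucket B).  TAG: WEAKER than row 18's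
  GR1‴ ∧ (G⁰)‴ (PROVED here: `layerGrowthOdd_of_growthLeOne_of_corankPos`, `s = 1`), hence than everything those are weaker than
  (K1‴ ∧ K2a‴ of `beta-road`); UNDECIDED; ENGINE NEW for this crux and Euler-system-free: (P) + (R) above — no Kolyvagin system, no
  `p`-adic `L`-function, no local indivisibility, no Cornut–Vatsal.  Leaf ATTACKABLE (size L: port Nekovář's ch. 10 duality + the
  DVR symplectic lemma to `p = 3 ∥ N′`; the printed parity theorems assume good ordinary reduction, `3 ∤ c_q` and no exceptional zero)
  · INSTRUMENTABLE per twin (`dim Sel₃(E′/K)`, `dim Sel₃(E′/K₁)` mod 2 by descent).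
* CUT‴ `ResidualFiniteOfOddGrowthMultAtThree` — per instance: fine `3`-torsion finite → odd growth → `Sel_(∅,0)[3]` finite (bucket B).
  TAG: UNDECIDED (implied by row 18's RANK‴ ∧ LINK‴ with (G⁰)‴, themselves open) · leaf ATTACKABLE (size M): the dichotomy (D) over
  the landed bricks `…TwoSidedLayerCountPT`, `…ResidualLayerControl`, `…ResidualLinkTransport`, `…LayerSelmerInjection`,
  `…StrictPlaceNoPTorsion`, `…TowerNoPTorsion`; the one new step is the direct-sum count `(𝓐 ⊕ τ𝓐) ∩ (ℓ ⊕ τℓ)`.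
  [cite: Castella2017HeegnerBeilinsonFlach, App. A (A.4)–(A.7) (shape)] [cite: GreenbergLNM1716, §1, §3]
* C₀′ `TwinAlgMuZeroAtThreeGoodSSOfParam` BY NAME (`stub_goodSS` of `beta-road` v19).  In C₀ (`a₃ = 0`) (P), (R), (D) hold verbatim for
  the `±`/signed corank-one conditions once these have control along the tower; with the plain Kummer condition (`Ω`-corank 2 above `𝔭`)
  (D) is empty — IDEA-NEEDED (rows `height-two-newton-signed-beta`, `signed_howard_half`).  Remark (not typed, costume-prone): the same
  τ-twist applied to the pairing between `X_(∅,0)` and `X_(0,∅)` (EXACT local duality at `𝔭, 𝔭′`, any reduction type) makes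
  `#{μ-summands of X_(∅,0)}` even in BOTH buckets, so crux ⟸ FINE‴ ∧ TORS(∅,0) everywhere.

**Composition** `TwinAlgMuZeroAtThree_of : FINE‴ → ODD‴ → CUT‴ → C₀′ → crux` — kernel-checked, concludes the crux BY NAME; bucket B through
the route receptacle `isTorsion_and_exists_generator_of_finite_pTorsion`; `sorry` ONLY inside the four `stub_*`.
**What the node buys (honest).**  Net in bucket B, given the algebraic CUT‴ and the parity engine ODD‴:  crux_B ⟺ FINE‴  (⟹ is
`fine_of_crux`).  Versus `beta-road`: K1‴ and K2a‴ both deleted.  Versus row 18 `tau-corank-link` (FINE‴ ∧ (G⁰)‴ ∧ GR1‴): the two growth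
BOUNDS `1 ≤ s_Gr ≤ 1` (Cornut–Vatsal port; residual Kolyvagin / Matar–Nekovář, which needs `y_K ∉ 3E′(K)`) are replaced by ONE parity
`s_Gr` odd, whose engine works for every index `t = [E′(K) : ℤy_K]₃` — the `t ≥ 1` pairs on which GR1‴ had no engine.  Versus row 21
(`universal-norm-defect`: parity of the radical `U` via derived heights at `(T)`): the parity here lives at the prime `(3)`, is read on the
Greenberg module (not on `X_(∅,0)`, where it would be costume under FINE‴), and needs no heights.
**Disproof used** (`Disproof.lean`, no kill): honours `twinAlgMuZeroAtThree_false_without_heegner` — Heegner is load-bearing through the SIGN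
in (R) (in the definite near-miss 15a1/`ℚ(√−23)` the rank `r` is even and (D) concludes nothing); surjectivity of `ρ̄₃` is consumed as
`E′(K_∞)[3] = 0` (finite `Ω`-torsion in (D), Kummer injectivity for the layer counts); the bucket guard selects the toric line `ℓ`; `Odd d_K` is
not load-bearing (consistent with `Negative/GuardCuts.lean`).  Negatives 24881/15532 are not instances of any stub.
-/

noncomputable section

open scoped Classical NumberField

set_option linter.dupNamespace false
set_option autoImplicit false

namespace Summit.BirchSwinnertonDyer.BirchSwinnertonDyer.Cruxes.TwinAlgMuZeroAtThree.DihedralParitySqueeze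

open NumberField IsDedekindDomain Field WeierstrassCurve Finset
open Literature.NumberTheory.EllipticCurves Literature.NumberTheory.EllipticCurves.IwasawaAlgebra
open Literature.NumberTheory.EllipticCurves.ZpExtension Literature.NumberTheory.EllipticCurves.GreenbergSelmer
open Summit.BirchSwinnertonDyer.Rank1Residual.X11b Summit.BirchSwinnertonDyer.Rank1Residual.X11b.AcSelmer
open Summit.BirchSwinnertonDyer.BirchSwinnertonDyer.Theorems
open Summit.BirchSwinnertonDyer.BirchSwinnertonDyer.Theorems.UniversalToricDescentAcDualMuZero
open Summit.BirchSwinnertonDyer.BirchSwinnertonDyer.Theorems.UniversalToricDescentStrictPlace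
open Summit.BirchSwinnertonDyer.BirchSwinnertonDyer.Theorems.UniversalToricDescentResidualLinkLayerRank
open Literature.NumberTheory.EllipticCurves.ModularForms (ModularParametrizationData heegnerPointComplexOfConductor)

/-! ## §0 Layer objects (abbreviations of tree objects; verbatim row 18's vocabulary; no new mathematics) -/

section LayerObjects

variable {K : Type} [Field K] [NumberField K]

/-- `S_n = Sel₃(E′/K_n) ⊆ H¹(Gal(K̄/K_n), E′[3])` — the residual Selmer group of the layer `K_n = K̄^{κ.layerSubgroup n}`
(Kummer conditions at every place), the tree's `WeierstrassCurve.selmerTorsionOver`. [cite: PerrinRiou1987BSMF, §0 p. 401] -/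
abbrev layerSel (W' : WeierstrassCurve ℚ) (κ : ZpExtension K 3) (n : ℕ) :
    AddSubgroup ((W'.baseChange K).torsionH1Over (3 : ℤ) (κ.layerSubgroup n)) :=
  (W'.baseChange K).selmerTorsionOver (κ.layerSubgroup n) (3 : ℤ)

/-- **Residual growth rate ≤ 1** (row 18's GR1, layer form; restated only for the evidence theorem below).
[cite: GreenbergLNM1716, §1 (PDF pp. 60–62)] -/
@[conjecture]
def LayerGrowthLeOne (W' : WeierstrassCurve ℚ) (κ : ZpExtension K 3) : Prop :=
  ∃ C : ℕ, ∀ n : ℕ,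
    (layerSel W' κ n : Set ((W'.baseChange K).torsionH1Over (3 : ℤ) (κ.layerSubgroup n))).Finite ∧
      Nat.card ↥(layerSel W' κ n) ≤ 3 ^ (3 ^ n + C)

/-- **Residual growth rate ≥ 1** (row 18's (G⁰), layer form; restated only for the evidence theorem below).
[cite: CornutVatsal2005, Thm. 1.10 (shape)] -/
@[conjecture]
def LayerCorankPos (W' : WeierstrassCurve ℚ) (κ : ZpExtension K 3) : Prop :=
  ∃ c : ℕ, ∀ n : ℕ, 3 ^ 3 ^ n ≤ Nat.card ↥(layerSel W' κ n) * 3 ^ c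

/-- **ODD GROWTH** (the node's new piece, layer form): `#Sel₃(E′/K_n) = 3^{s·3ⁿ + O(1)}` for an ODD `s` — two-sided, with `Sel₃(E′/K_n)`
finite part of the statement (no junk: an infinite layer has `Nat.card = 0 < 3^{s·3ⁿ}`).  `s = rank_Λ X_Gr + #{μ-summands}`; (P) makes the
second summand even, (R) the first odd. [cite: Nekovar2006, 10.7.15(iii), 10.7.17 (shape: odd coranks along K_−)]
[cite: Howard2004HeegnerKolyvagin, Thm. 1.4.2 (shape: `R^ε ⊕ M ⊕ M`)] -/
@[conjecture]
def LayerGrowthOdd (W' : WeierstrassCurve ℚ) (κ : ZpExtension K 3) : Prop :=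
  ∃ s C : ℕ, Odd s ∧ ∀ n : ℕ,
    (layerSel W' κ n : Set ((W'.baseChange K).torsionH1Over (3 : ℤ) (κ.layerSubgroup n))).Finite ∧
      Nat.card ↥(layerSel W' κ n) ≤ 3 ^ (s * 3 ^ n + C) ∧ 3 ^ (s * 3 ^ n) ≤ Nat.card ↥(layerSel W' κ n) * 3 ^ C

end LayerObjects

/-! ## §1 The pieces (Props only; nothing asserted) -/

/-- **FINE‴ — `Sel₀(K_∞, E′[3^∞])[3]` is finite** (anticyclotomic Coates–Sujatha A/B for the twin at `p = 3`), crux binders verbatim,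
both buckets; verbatim the g8 piece `FineSelmerCut.FineSelmerThreeTorsionFiniteAtThree` (= row 18's).  TAG: WEAKER than the crux
(`fine_of_crux`); INSTRUMENTABLE; class-wide IDEA-NEEDED. [cite: Matar2018, Conj. B, Thm. 4.1] [cite: CoatesSujatha2005, Conj. A] -/
@[conjecture]
def FineSelmerThreeTorsionFiniteAtThree : Prop :=
    ∀ (W' : WeierstrassCurve ℚ) [W'.IsElliptic] [W'.IsGloballyMinimal] (N' : ℕ) [NeZero N']
      (K : Type) [Field K] [NumberField K] (_Dt' : ModularParametrizationData W' N'),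
      (Rank1Residual.Mult W' 3 ∧ ¬ 3 ∣ padicValInt 3 W'.minimalDiscriminantInt ∨
        Rank1Residual.GoodSS W' 3 ∧ W'.frobeniusTrace 3 = 0) →
      W'.HasSurjectiveModNGaloisRep 3 → W'.conductorNorm ℤ = N' → IsImaginaryQuadratic K →
      SatisfiesHeegnerHypothesis N' K → Odd (NumberField.discr K) →
      ∀ (κ : ZpExtension K 3), κ.IsAnticyclotomic →
      ∀ (γ : absoluteGaloisGroup K) [Fact (κ.IsTopGenerator γ)]
        (𝔭 : HeightOneSpectrum (𝓞 K)), ((3 : ℕ) : 𝓞 K) ∈ 𝔭.asIdeal →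
        𝔭.asIdeal.ramificationIdx (𝓞 ℚ) = 1 → 𝔭.asIdeal.inertiaDeg (𝓞 ℚ) = 1 →
      ∀ (𝔭' : HeightOneSpectrum (𝓞 K)), ((3 : ℕ) : 𝓞 K) ∈ 𝔭'.asIdeal → 𝔭' ≠ 𝔭 →
      Set.Finite {s : (W'.baseChange K).fineSelmerInfty κ | (3 : ℕ) • s = 0}

/-- **ODD‴ — the residual Selmer groups of the anticyclotomic layers grow at an ODD rate** (bucket B):
`∃ s odd, C: 3^{s·3ⁿ} ≤ #Sel₃(E′/K_n)·3^C ∧ #Sel₃(E′/K_n) ≤ 3^{s·3ⁿ+C}`.  THE NODE'S LEVER: (P) the τ-twisted `Λ_(3)`-adic Cassels–Tate form on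
`(X_Gr,tors)_(3)` is bilinear alternating perfect ⟹ `M ⊕ M` ⟹ `#μ`-summands even; (R) `rank_Λ X_Gr` odd (3-parity over `K` + sign `−1` +
τ-paired control).  TAG: WEAKER than GR1‴ ∧ (G⁰)‴ (`layerGrowthOdd_of_growthLeOne_of_corankPos`) · UNDECIDED · leaf ATTACKABLE (L; port of
Nekovář ch. 10 / Flach to multiplicative `p = 3 ∥ N′`: printed parity theorems assume good ordinary, `3 ∤ c_q`, no exceptional zero) ·
INSTRUMENTABLE (parity of `dim Sel₃(E′/K)`, `dim Sel₃(E′/K₁)`). [cite: Nekovar2006, §10.2–10.5, 10.7.15(iii), 10.7.17, 10.7.19]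
[cite: Flach1990, Thm. 1–2] [cite: Howard2004HeegnerKolyvagin, H.4, Prop. 1.4.1, Thm. 1.4.2] [cite: DokchitserDokchitserAnnals2010, Thm. 1.2]
[cite: MazurRubin2007, Thm. 3.1 (shape; good ordinary there)] [cite: MatarNekovar2019, Prop. 3.2(1) (shape; good ordinary there)] -/
@[conjecture]
def SelmerLayerGrowthOddMultAtThree : Prop :=
    ∀ (W' : WeierstrassCurve ℚ) [W'.IsElliptic] [W'.IsGloballyMinimal] (N' : ℕ) [NeZero N']
      (K : Type) [Field K] [NumberField K] (_Dt' : ModularParametrizationData W' N'),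
      Rank1Residual.Mult W' 3 → ¬ 3 ∣ padicValInt 3 W'.minimalDiscriminantInt →
      W'.HasSurjectiveModNGaloisRep 3 → W'.conductorNorm ℤ = N' → IsImaginaryQuadratic K →
      SatisfiesHeegnerHypothesis N' K → Odd (NumberField.discr K) →
      ∀ (κ : ZpExtension K 3), κ.IsAnticyclotomic → LayerGrowthOdd W' κ

/-- **CUT‴ — the τ-Poitou–Tate dichotomy, per instance** (bucket B): if the fine `3`-torsion `Sel₀(K_∞, E′[3^∞])[3]` is finite and the
residual Selmer groups of the layers grow at an odd rate, then `Sel_(∅ at 𝔭, 0 at 𝔭′)(K_∞, E′[3^∞])[3]` is finite.  Mechanism (D) of the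
module docstring: the global image in the local cohomology has `Ω`-corank exactly `2`; `τ` forces the bad summand `(𝓐 ⊕ τ𝓐) ∩ (ℓ ⊕ τℓ)` to
have EVEN corank; odd `s_Gr − s_fine` excludes it.  TAG: UNDECIDED · leaf ATTACKABLE (size M; bricks `…TwoSidedLayerCountPT`,
`…ResidualLayerControl`, `…ResidualLinkTransport`, `…LayerSelmerInjection`, `…StrictPlaceNoPTorsion` BY NAME + `Ω`-corank calculus).
[cite: GreenbergLNM1716, §1, §3] [cite: Castella2017HeegnerBeilinsonFlach, App. A (A.4)–(A.7) (shape)] [cite: Matar2018, Thm. 3.3(a) (the τ-argument, shape)] -/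
@[conjecture]
def ResidualFiniteOfOddGrowthMultAtThree : Prop :=
    ∀ (W' : WeierstrassCurve ℚ) [W'.IsElliptic] [W'.IsGloballyMinimal] (N' : ℕ) [NeZero N']
      (K : Type) [Field K] [NumberField K] (_Dt' : ModularParametrizationData W' N'),
      Rank1Residual.Mult W' 3 → ¬ 3 ∣ padicValInt 3 W'.minimalDiscriminantInt →
      W'.HasSurjectiveModNGaloisRep 3 → W'.conductorNorm ℤ = N' → IsImaginaryQuadratic K →
      SatisfiesHeegnerHypothesis N' K → Odd (NumberField.discr K) →
      ∀ (κ : ZpExtension K 3), κ.IsAnticyclotomic →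
      ∀ (γ : absoluteGaloisGroup K) [Fact (κ.IsTopGenerator γ)]
        (𝔭 : HeightOneSpectrum (𝓞 K)), ((3 : ℕ) : 𝓞 K) ∈ 𝔭.asIdeal →
        𝔭.asIdeal.ramificationIdx (𝓞 ℚ) = 1 → 𝔭.asIdeal.inertiaDeg (𝓞 ℚ) = 1 →
      ∀ (𝔭' : HeightOneSpectrum (𝓞 K)), ((3 : ℕ) : 𝓞 K) ∈ 𝔭'.asIdeal → 𝔭' ≠ 𝔭 →
      Set.Finite {s : (W'.baseChange K).fineSelmerInfty κ | (3 : ℕ) • s = 0} → LayerGrowthOdd W' κ →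
      Set.Finite {s : selmerAc (W'.baseChange K) 3 κ 𝔭' ∅ | 3 • s = 0}

/-! ## §2 Evidence for the tags (no `sorry`) -/

/-- **ODD‴ is WEAKER than GR1‴ ∧ (G⁰)‴** (row 18's two growth bounds): growth rate exactly one is an odd growth rate (`s = 1`).
[folklore] -/
theorem layerGrowthOdd_of_growthLeOne_of_corankPos {K : Type} [Field K] [NumberField K] {W' : WeierstrassCurve ℚ}
    {κ : ZpExtension K 3} (h1 : LayerGrowthLeOne W' κ) (h0 : LayerCorankPos W' κ) : LayerGrowthOdd W' κ := by
  obtain ⟨C, hC⟩ := h1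
  obtain ⟨c, hc⟩ := h0
  refine ⟨1, C + c, odd_one, fun n ↦ ⟨(hC n).1, ?_, ?_⟩⟩
  · calc Nat.card ↥(layerSel W' κ n) ≤ 3 ^ (3 ^ n + C) := (hC n).2
      _ ≤ 3 ^ (1 * 3 ^ n + (C + c)) := Nat.pow_le_pow_right (by norm_num) (by omega)
  · calc 3 ^ (1 * 3 ^ n) = 3 ^ 3 ^ n := by rw [one_mul]
      _ ≤ Nat.card ↥(layerSel W' κ n) * 3 ^ c := hc n
      _ ≤ Nat.card ↥(layerSel W' κ n) * 3 ^ (C + c) :=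
        Nat.mul_le_mul_left _ (Nat.pow_le_pow_right (by norm_num) (by omega))

/-- `Sel₀(K_∞, E[p^∞]) ≤ Sel_𝔭^Σ(K_∞, E[p^∞])` (verbatim the g8 lemma): the fine datum at `𝔭` IS Castella's strict datum.
[cite: Greenberg1989, §1 p. 98] [cite: Castella2018, Def. 2.2] -/
theorem fineSelmerInfty_le_selmerAc {K : Type} [Field K] [NumberField K] (W : WeierstrassCurve K) (p : ℕ)
    [Fact p.Prime] (κ : ZpExtension K p) (𝔭 : HeightOneSpectrum (𝓞 K)) (h𝔭 : ((p : ℕ) : 𝓞 K) ∈ 𝔭.asIdeal)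
    (S : Set (HeightOneSpectrum (𝓞 K))) :
    W.fineSelmerInfty κ ≤ selmerAc W p κ 𝔭 S := by
  intro c hc
  have hc' := (mem_strictSelmerGroupOver_iff c).mp hc
  exact (mem_selmerOver_iff c).mpr
    ⟨fun v hv _ σ ↦ hc'.1 v hv σ, hc'.2.1, fun σ ↦ hc'.2.2 𝔭 h𝔭 σ⟩

/-- Finiteness of the `n`-torsion passes to a smaller additive subgroup (verbatim the g8 lemma). [folklore] -/
theorem finite_nsmul_eq_zero_of_le {A : Type*} [AddCommGroup A] {B C : AddSubgroup A} (hle : B ≤ C) (n : ℕ)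
    (h : Set.Finite {s : C | n • s = 0}) : Set.Finite {s : B | n • s = 0} := by
  let ι : B → C := fun s ↦ ⟨s.1, hle s.2⟩
  have hι : Function.Injective ι := by
    intro a b hab
    apply Subtype.ext
    have h1 : ((ι a : C) : A) = ((ι b : C) : A) := congrArg Subtype.val hab
    exact h1
  refine Set.Finite.of_finite_image (h.subset ?_) hι.injOn
  rintro _ ⟨s, hs, rfl⟩
  have hs' : n • (s : A) = 0 := by
    have h1 := congrArg Subtype.val hs
    simpa using h1
  show n • ι s = 0
  exact Subtype.ext (by simpa [ι] using hs')

/-- **crux ⟹ FINE‴** (FINE‴ is WEAKER than the crux, both buckets; verbatim the g8 proof). [cite: Washington1997, §13.2] -/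
theorem fine_of_crux
    (h : Summit.BirchSwinnertonDyer.BirchSwinnertonDyer.Theses.UniversalToricDescent.TwinAlgMuZeroAtThree) :
    FineSelmerThreeTorsionFiniteAtThree := by
  intro W' _ _ N' _ K _ _ Dt' hbucket hsurj hN hK hH hodd κ hκ γ _ 𝔭 h𝔭 he hf 𝔭' h𝔭' hne
  obtain ⟨htors, g, hg, hi⟩ := h W' N' K Dt' hbucket hsurj hN hK hH hodd κ hκ γ 𝔭 h𝔭 he hf 𝔭' h𝔭' hne
  have hfin := finite_pTorsion_of_isTorsion_of_exists_generator
    (W'.baseChange K) 3 κ 𝔭' ∅ γ Set.finite_empty htors ⟨g, hg, hi⟩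
  exact finite_nsmul_eq_zero_of_le (fineSelmerInfty_le_selmerAc (W'.baseChange K) 3 κ 𝔭' h𝔭' ∅) 3 hfin

/-! ## §3 The four stubs of the node (the ONLY `sorry`s of this file) -/

/-- **stub FINE‴** — anticyclotomic Coates–Sujatha at `p = 3` for the twin (shared with nodes `fine-selmer-cut`, `tau-corank-link`).
UNDECIDED · INSTRUMENTABLE · class-wide IDEA-NEEDED. [cite: Matar2018, Conj. B, Thm. 4.1] [cite: CoatesSujatha2005, Conj. A] -/
theorem stub_fine : FineSelmerThreeTorsionFiniteAtThree := by
  sorry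

/-- **stub ODD‴** — odd growth of `#Sel₃(E′/K_n)` (bucket B): (P) Cassels–Tate square at `(3)` via the `τ`-twist + (R) rank parity.
UNDECIDED · ATTACKABLE (L) · INSTRUMENTABLE. [cite: Nekovar2006, 10.7.15(iii), 10.7.17] [cite: Flach1990, Thm. 1–2]
[cite: DokchitserDokchitserAnnals2010, Thm. 1.2] -/
theorem stub_oddGrowth : SelmerLayerGrowthOddMultAtThree := by
  sorry

/-- **stub CUT‴** — the τ-Poitou–Tate dichotomy (bucket B).  UNDECIDED · ATTACKABLE (M).
[cite: GreenbergLNM1716, §1, §3] [cite: Castella2017HeegnerBeilinsonFlach, App. A (shape)] -/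
theorem stub_parityCut : ResidualFiniteOfOddGrowthMultAtThree := by
  sorry

/-- **stub C₀′** (`TwinAlgMuZeroAtThreeGoodSSOfParam`) BY NAME — unchanged from line `beta-road` v19.
[cite: Howard2004HeegnerKolyvagin, Thm. B (shape)] -/
theorem stub_goodSS : UniversalToricDescentBetaRoadParamDefs.TwinAlgMuZeroAtThreeGoodSSOfParam := by
  sorry

/-! ## §4 Composition: the crux BY NAME -/

/-- **Crux 24737 `TwinAlgMuZeroAtThree` BY NAME from the node's pieces.**  Bucket B: FINE‴ gives the fine instance, ODD‴ the odd growth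
rate, CUT‴ the finiteness of `Sel_(∅,0)(K_∞, E′[3^∞])[3]`, and the route receptacle `isTorsion_and_exists_generator_of_finite_pTorsion`
concludes.  Bucket C₀: C₀′ BY NAME.  No `sorry` here. [cite: GreenbergVatsal2000, §2 Prop. (2.8)] -/
theorem TwinAlgMuZeroAtThree_of
    (hF : FineSelmerThreeTorsionFiniteAtThree) (hpar : SelmerLayerGrowthOddMultAtThree)
    (hcut : ResidualFiniteOfOddGrowthMultAtThree)
    (hC0 : UniversalToricDescentBetaRoadParamDefs.TwinAlgMuZeroAtThreeGoodSSOfParam) :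
    Summit.BirchSwinnertonDyer.BirchSwinnertonDyer.Theses.UniversalToricDescent.TwinAlgMuZeroAtThree := by
  intro W' _ _ N' _ K _ _ Dt' hbucket hsurj hN hK hH hodd κ hκ γ _ 𝔭 h𝔭 he hf 𝔭' h𝔭' hne
  rcases hbucket with ⟨hm, htr⟩ | ⟨hss, ha⟩
  · -- the fine instance (FINE‴ at this datum)
    have hfine : Set.Finite {s : (W'.baseChange K).fineSelmerInfty κ | (3 : ℕ) • s = 0} :=
      hF W' N' K Dt' (Or.inl ⟨hm, htr⟩) hsurj hN hK hH hodd κ hκ γ 𝔭 h𝔭 he hf 𝔭' h𝔭' hne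
    -- odd growth of the residual Selmer groups of the layers
    have hgr : LayerGrowthOdd W' κ := hpar W' N' K Dt' hm htr hsurj hN hK hH hodd κ hκ
    -- the τ-Poitou–Tate dichotomy
    have hfin : Set.Finite {s : selmerAc (W'.baseChange K) 3 κ 𝔭' ∅ | 3 • s = 0} :=
      hcut W' N' K Dt' hm htr hsurj hN hK hH hodd κ hκ γ 𝔭 h𝔭 he hf 𝔭' h𝔭' hne hfine hgr
    -- the landed receptacle
    haveI : (W'.baseChange K).IsElliptic := by rw [WeierstrassCurve.baseChange]; infer_instance
    exact isTorsion_and_exists_generator_of_finite_pTorsion (W'.baseChange K) 3 κ 𝔭' ∅ γ Set.finite_empty hfin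
  · exact (UniversalToricDescentBetaRoadParamDefs.twinAlgMuZeroAtThreeGoodSSOfParam_iff.mp hC0)
      W' N' K Dt' hss ha hsurj hN hK hH hodd κ hκ γ 𝔭 h𝔭 he hf 𝔭' h𝔭' hne

/-- **The node closes the crux from its four stubs** (inherits their `sorry`s). -/
theorem TwinAlgMuZeroAtThree_of_stubs :
    Summit.BirchSwinnertonDyer.BirchSwinnertonDyer.Theses.UniversalToricDescent.TwinAlgMuZeroAtThree :=
  TwinAlgMuZeroAtThree_of stub_fine stub_oddGrowth stub_parityCut stub_goodSS

/-- **Sanity: the line of record implies the node's FINE‴** (K1‴ ∧ K2a‴ ∧ C₀′ ⟹ crux ⟹ FINE‴), so the node does not strengthen the leaf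
shared with `fine-selmer-cut` / `tau-corank-link`. [cite: Howard2004HeegnerKolyvagin, Thm. 2.3.1 (shape only)] -/
theorem fine_of_betaRoadParamStubs
    (hK1 : UniversalToricDescentBetaRoadParamDefs.PrincipalHeegnerIndivisibleMultOfParamAtThree)
    (hK2 : UniversalToricDescentKsTwinLambdaDefs.KsTwinLambdaAdicAtThree)
    (hC0 : UniversalToricDescentBetaRoadParamDefs.TwinAlgMuZeroAtThreeGoodSSOfParam) :
    FineSelmerThreeTorsionFiniteAtThree :=
  fine_of_crux (UniversalToricDescentTwinAlgMuZeroAtThreeOfBetaRoadParam.twinAlgMuZeroAtThree_of_betaRoadParamStubs hK1 hK2 hC0)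

end Summit.BirchSwinnertonDyer.BirchSwinnertonDyer.Cruxes.TwinAlgMuZeroAtThree.DihedralParitySqueeze

end
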